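import Literature.MathematicalPhysics.QuantumLattice.HubbardFermiSeaTangentRowsDiluteFarTPrime
import Literature.MathematicalPhysics.QuantumLattice.HubbardFermiSeaTangentRowsQuarterFilling
import Literature.MathematicalPhysics.QuantumLattice.HubbardNNNHoppingEnergyDensityMonotone
import Summits.Ventures.CertifiedManyBodySolver.Certificates.HubbardSquare_n1_deepSheet_farColumnFloors_E
import Summits.Ventures.CertifiedManyBodySolver.Certificates.HubbardSquare_n1_deepSheet_farColumnFloors_F
import Summits.Ventures.CertifiedManyBodySolver.Certificates.HubbardSquare_n1_deepSheet_farColumnFloors_G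
import Summits.Ventures.CertifiedManyBodySolver.Certificates.HubbardSquare_n1_deepSheet_farColumnFloors_K5a
import Summits.Ventures.CertifiedManyBodySolver.Certificates.HubbardSquare_n1_deepSheet_farColumnFloors_K5b
import Summits.Ventures.CertifiedManyBodySolver.Certificates.HubbardSquare_n1_deepSheet_farColumnFloors_K5c
import Summits.Ventures.CertifiedManyBodySolver.Certificates.HubbardSquare_n1_deepSheet_farColumnFloors_K5d
import Summits.Ventures.CertifiedManyBodySolver.Certificates.HubbardSquare_n1o2_farstrip_lower_jensen606_674_649
import Summits.Ventures.CertifiedManyBodySolver.Certificates.HubbardSquare_n7o8_TKT_obliqueStation_splitPlane_r554_r555_r590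
import Summits.Ventures.CertifiedManyBodySolver.Certificates.HubbardSquare_n7o8_splitPlane2_stage2_byName_discharge
import Summits.Ventures.CertifiedManyBodySolver.Certificates.HubbardSquare_n7o8_splitPlaneQ1_byName_readers
import Summits.Ventures.CertifiedManyBodySolver.Certificates.HubbardTTPrime_polarizedBandCaps_kernelA
import Summits.Ventures.CertifiedManyBodySolver.Observables.PhaseSeparationExclusionBox
import Summits.Ventures.CertifiedManyBodySolver.Observables.PhaseSeparationExclusionBoxThermalFreeDilute
import Summits.Ventures.CertifiedManyBodySolver.Observables.PhaseSeparationExclusionFarNearCornerColumns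
import Summits.Ventures.CertifiedManyBodySolver.Observables.PhaseSeparationExclusionFarQuarterNodes
import Summits.Ventures.CertifiedManyBodySolver.Observables.PhaseSeparationExclusionHalfFillingColumnU5
import Summits.Ventures.CertifiedManyBodySolver.Observables.PhaseSeparationExclusionHolePlaneCap
import Summits.Ventures.CertifiedManyBodySolver.Observables.PhaseSeparationExclusionMidSegmentCapThermal
import Summits.Ventures.CertifiedManyBodySolver.Observables.PhaseSeparationExclusionMidSegmentCapThermalFarPlanesB
import Summits.Ventures.CertifiedManyBodySolver.Observables.PhaseSeparationExclusionNearStripElectronSideColumns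
import Summits.Ventures.CertifiedManyBodySolver.Observables.PhaseSeparationExclusionQuarterConvexFloor
import Summits.Ventures.CertifiedManyBodySolver.Observables.PhaseSeparationExclusionSplitPlaneSevenEighthsCap
import Summits.Ventures.CertifiedManyBodySolver.Observables.PhaseSeparationExclusionStripPolCaps
import Summits.Ventures.CertifiedManyBodySolver.Observables.PhaseSeparationExclusionTPrimeStripEXT5
import Summits.Ventures.CertifiedManyBodySolver.Observables.PhaseSeparationExclusionVirtualColumns
import Summits.Ventures.CertifiedManyBodySolver.Observables.PhaseSeparationExclusionWitnessSplitCap597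
import HarnessLib
import HarnessLib.Audit

/-!
# Ventures/CertifiedManyBodySolver — Observables/PhaseSeparationExclusionNearStripCVK5ThermalA1P2B.lean: `(≤ 1/4 | ≥ 1)` AT `T > 0` on the near-far segment `t′ ∈ [−2/5, −7/20]` (CCOC / NdNiO₂ / Tl2201 / Bi2201 / M57 boxes)

K5 CORNER-LAW edition («THE K5 CORNER LAWS», hubbard-downfold-unc-2 g42, families K5…; generator `gen-g42/yb/gen42.py` over g41's): the `n = 1` column of the far cells at `U ∈ [49/10, 13/2]` may now be one of hubbard-box-eng-2 g23's RE-FLOORED deep-sheet laws `ds2_n1_law_U<U>_m<a>m<b>` (`Certificates/HubbardSquare_n1_deepSheet_farColumnFloors_K5{a,b,c,d}.lean`, C-174, ref-3 § F3-121 PASS 92/92): `t′`-chords of LP-exact simplex corners (`ds_n1_simplex3`: joint concavity of `(s,U) ↦ e(1,s,U,1)`, evenness + `t′`-monotonicity at `n = 1`, `U`-monotonicity) of the K-R1′ `(5,1,+1/2)` half-filling row (`hK5p50n1` BY VALUE, CANDIDATE class — hubbard-algo-eng-8 g8 kit j342506, CLAIM algoeng8-20260831-01, algo-ref g65 CELL-SIDE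 PASS), the M64 deep hole-side XL rows at `s = −16/25` (`hsX49o10m64n1` ∕ `hsX717o100m64n1`, fast-ref F99 ∕ F103 PASS), the B54 `(6,1,±3/10)` floor (`hB54`) and CERTIFIED #497 `(4,1,0)` BY NAME (`h497`): `(5,1,s) ≥ −0.8295 ∣ −0.8242 ∣ −0.8189` at `s = −2/5 ∣ −7/20 ∣ −3/10` (the flat `u5_n1_law_U5_m50p0` read −0.8402), `−0.8349` at `−9/20`; columns at `U = 49/10 ∣ 51/10 ∣ 133/25 ∣ 141/25 ∣ 6` and their `U`-chords `vk…` (`vcol_of_laws`) at `21/4 ∣ 11/2 ∣ 23/4`. The far quarter-filling points enter BY NAME: CERTIFIED #770 `(8,1/2,−2/5)` ∕ #783 `(6,1/2,−2/5)` claim nodes (`h770 : cert_r770_…` ∕ `h783 : cert_r783_…`, lit-4 p807955 ∕ p816497) through `hQ8m40_of_node` ∕ `hQ6m40_of_node` (`Observables/PhaseSeparationExclusionFarQuarterNodes.lean`, this seat). (5,1,+1/2) COLUMN edition (hubbard-downfold-unc-2 g41, families U5…): the `n = 1` column at `U ∈ [5, 6)` of the far cells with `|t′| ≤ 1/2` is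 the K-R1′ LEG B half-filling row (hubbard-algo-eng-8 g8 `twinchain-U5n1tp1o2-v082` kit j342506, see the law file's docstring for the exact literal and its class) read on the hole side by evenness + `t′`-monotonicity at `n = 1` (`u5_n1_law_U5_m50p0`, `Observables/PhaseSeparationExclusionHalfFillingColumnU5.lean`, hypothesis `hK5p50n1` BY VALUE) and its `U`-chords `vcol_of_laws` with the deep-sheet `U = 6` laws at `U ∈ {21/4, 11/2, 141/25, 23/4}` wherever they beat the deep-sheet `U = 5` column (−0.8716 ∣ −0.8632 ∣ −0.8548 at s = −1/2 ∣ −9/20 ∣ −2/5). WAVE-7c ITEM 2 edition («THE U = 6 QUARTER POINT», hubbard-downfold-unc-2 g41, generator `gen-g41/yb/gen41.py …` over the g40/g39/g38 generators; floor kinds `Q649`/`Q6F` next to g40's `Q606`/`Q674`/`QF`): the DILUTE floor at `n₁ = 1/2` may now use the FIRST quarter-filling e₀ LOWER at `U = 6`, `t′ < −3/10` — hubbard-algo-eng-8 g7's `GU6n1o2tpm2o5` (6, 1/2, −2/5) one-job n-twin chain RESULT (EXACT) kit j341763, `E_cert = −2729691028003404047260271/(5·2⁷⁹)` ⇒ floor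 `−0.9031789987` (hubbard-fast WAVE 7c ITEM 2; CLAIM algoeng8-20260830-11; algo-ref g65 CELL-SIDE PASS «CANDIDATE class, C48 legs pending», KEEP CORRECT; crit-1 S#484 CLEAN, crit-2 #332 CONCUR, captain RULINGS #973/#976 2026-08-30T23:5xZ; registry row #783 SIGNED (sr-mbsolver-ref-3 R3.498-57s) ⇒ NOW CERTIFIED #783 and read BY NAME: binder `h783 : cert_r783_bs_GU6n1o2tpm2o5_…` (lit-4 g40 p816497) through `hQ6m40_of_node` (`Observables/PhaseSeparationExclusionFarQuarterNodes.lean`)): on `[−2/5, −3/10]` its `t′`-chord with the CERTIFIED #649 `(6,1/2,−3/10)` lower (−0.9412223802) at `U = 6` carried up in `U` (`−0.9032 ∣ −0.9222 ∣ −0.9412` at `s = −2/5 ∣ −7/20 ∣ −3/10`, i.e. `+0.053 ∣ +0.026 ∣ 0` over the #649 Jensen floor and `+0.044 ∣ +0.015` over #606's for `U < 8`), and on `[−11/20, −2/5]` its `(t′,U)`-Jensen chord with the kernel free row at `t′ = −11/20` (`−0.9082` at `s = −41/100`, `−0.9283` at `−9/20`; valid for `U ≥ 40(s + 11/20)`,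 i.e. from `U = 6` at `s = −2/5` where the `U = 8` point needs `U ≥ 8`); extrapolated down the density by convexity for `(≤ 9/20 ∣ ≥ 1)` / `(≤ 2/5 ∣ ≥ 1)` exactly as the Q8/J floors. The STAGE-2 `7/8` plane is read BY NAME (`n7o8_splitPlane2_hW2m_of_node hW2o3` on `cert_plaqseam_W4splitO3_TBDP_allmk`, hubbard-fast-reuse-2 g21) wherever it caps. DEEP-SHEET COLUMN edition («THE FAR COLUMN REPAIR», hubbard-downfold-unc-2 g40, families DS/DSH200/DSH80): the `n = 1` COLUMNS of every far cell are hubbard-box-eng-2 g22's DEEP-SHEET far column laws `ds_n1_law_U<U>_m<a>m<b>` BY NAME (`Certificates/HubbardSquare_n1_deepSheet_farColumnFloors_{B..I}.lean`, 2026-08-30T21:27Z: LP-exact simplex floors from the deep hole-side M64 XL rows at `s = −16/25` (`hsX49o10m64n1` ∕ `hsX717o100m64n1` ∕ `hsX10m64n1`, fast-ref F99/F103 PASS), the electron-side B54/B67c/B85c rows, the S1/S9 sheets and #497, by `t′`-monotonicity of `e(1,·,U,1)` on `s ≤ 0` (evenness + concavity) + `U`-monotonicity + joint concavity; `+0.05…0.21·t`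 over every earlier far column incl. this seat's (8,12)-chords and corner chords) wherever they are the best law on the cell's segment (the theorem docstrings name the law per column); their by-value binders appear in each signature exactly as the law files print them. WAVE-7c QUARTER-POINT edition (this file; hubbard-downfold-unc-2 g40, generator `gen-g40/yb/gen40.py … ` with the `Q606`/`Q674`/`QF` floor kinds): the DILUTE floor at `n₁ = 1/2` may now use the FIRST quarter-filling e₀ LOWER at `t′ < −3/10` — hubbard-algo-eng-8 g7's `GU8n1o2tpm2o5` (8, 1/2, −2/5) twin-chain RESULT (EXACT) kit j341204, `E_cert = −676700214379598560086999/(5·2⁷⁷) = −0.8956052766` (hubbard-fast WAVE 7c ITEM 1; crit-2 VERDICT #315, surr-4 SCORE, crit-1 S#467 CLEAN, captain RULINGS #919 «PRINTED, KEEP-class CANDIDATE», 2026-08-30T20:19–20:25Z; registry row #783 SIGNED (sr-mbsolver-ref-3 R3.498-57s) ⇒ hypothesis `hQ8m40 : −0.8956052766… ≤ e(1, −2/5, 8, 1/2)` BY VALUE, CANDIDATE class, discharged BY NAME by a one-line wrapper the hour the node lands): on `[−2/5, −3/10]` its `t′`-chord with the CERTIFIED #606 `(8,1/2,−3/10)`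 (−0.9270952558) ∣ #674 `(10,1/2,−3/10)` (−0.9178886431) lowers at `U = 8 ∣ 10` carried up in `U` (`−0.8956 ∣ −0.9113 ∣ −0.9271` at `s = −2/5 ∣ −7/20 ∣ −3/10`, i.e. `+0.052 ∣ +0.026` over the #606 Jensen floor and `+0.047 ∣ +0.019` over #674's), and on `[−11/20, −2/5]` its `(t′,U)`-Jensen chord with the kernel free row at `t′ = −11/20` (`−0.9011` at `s = −41/100`, `+0.044`; valid for `U ≥ 160(s + 11/20)/3`); extrapolated down the density by convexity for `(≤ 9/20 ∣ ≥ 1)` / `(≤ 2/5 ∣ ≥ 1)` exactly as the J-floors. FAR VIRTUAL-COLUMN edition («THE (8,12) CHORD», hubbard-downfold-unc-2 g40, generator `gen-g40/yb/gen40.py …`): on the far strips the `n = 1` COLUMNS at `U⋆ ∈ {42/5, 17/2, 9, 10, 11}` are now VIRTUAL columns (`vcol_of_laws`, `Observables/PhaseSeparationExclusionVirtualColumns.lean`, g37 device: concavity of `U ↦ e(1,s,U,1)`, the `U`-chord of two LANDED column laws read at `U⋆`) of the `U = 8` law `ext5_n1_col8_m40` ∕ `fp_n1_col8_m65m40` and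 the `U = 12` law `fp_n1_col12_m50m30` ∕ `fp_n1_col12_m65m50` BY NAME (their producer anchors `hsX8m40n1`, `h428`, `hN12m50`, `hsX12m30n1`, … exactly as printed in those laws): on `[−2/5,−3/10]` the chord reads `−0.5465 ∣ −0.4814` at `(10, s = −2/5 ∣ −3/10)` and `−0.5615 ∣ −0.5471` at `U⋆ = 17/2`, i.e. `0.065–0.093·t` ABOVE the N1-tier point floors `hN10m40`/`hN10m35` (`far_n1_col10_m40m35` −0.6110 ∣ −0.5917, `far_n1_law10`) and the box-eng sheet column `fy1_col17o2_m40m30` (−0.6475 ∣ −0.6402) that every earlier far edition used at `U = 17/2, 9, 10, 11` — the loosest ingredient of the far words was the `n = 1` column, not the cap: `(≤ 1/2 ∣ ≥ 1)` `T = 0` margins on A2 `[8,10] ∣ [10,12]` 0.033 ∣ 0.036 → 0.077 ∣ 0.074, A1 0.034 → 0.063 ∣ 0.057, E3c 0.036 → 0.056; no new row, no new hypothesis kind. 7/8-WITNESS menu («THE 7/8 WITNESS», hubbard-downfold-unc-2 g40, generator `gen-g40/yb/gen40.py …` over the g39/g38/g31 generators): the CAP menu of every cell now also holds the FOUR `n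 = 7/8` WITNESS-SPLIT cap planes of the pub/hubbard-fast reuse lane (reader spelling `∀ U s, 0 ≤ U → s ≤ 0 → e(1,s,U,7/8) ≤ T⁺ + D⁺·U + (−B⁺)·s`, cell form `holePlaneUS_tcap_on_cell`, `Observables/PhaseSeparationExclusionSplitPlaneSevenEighthsCap.lean`, this seat g40): the folded-Q1 `(5,7/8,−3/10)` state's plane BY NAME (`n7o8_splitPlaneQ1_of_split hQ1`, node `cert_plaqseam_W4splitQ1_TBD_allmk`, CERTIFIED #693–#695; lowest `7/8` cap for `U ≲ 6.0–6.3`), the #596 `(8,7/8,−3/10)` state's plane BY NAME (`n7o8_splitPlane_of_split hS596`, node `cert_plaqseam_W4split596_TBD_allmk`, CERTIFIED #610–#612), the STAGE-2 plane BY VALUE (`hW2m`, R12.52; lowest for `6.3 ≲ U ≲ 8.9–10.5`) and the V18 «WSP7» plane of the CERTIFIED dressed `(12,7/8,−3/10)` strip state BY VALUE (`hW7m`, R12.91 ×3, readers p782947; lowest above) — so the witness filling of a word may be `7/8` (weights `a = (1/8)/(1 − n₁)`, `b = 1 − a`: the dilute floor weighs `1/4` at `n₁ = 1/2` instead of `1/2`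 with the `3/4` planes), chosen per cell whenever it gives the better word (lower `β₀` ∕ larger margin ∕ stronger axis); every other ingredient as in the g39/g38 editions below. FAR-STRIP QUARTER-FLOOR edition («THE FAR-STRIP QUARTER FLOOR», hubbard-downfold-unc-2 g39, generator `gen-g39/yb/gen39.py far …` over the g38/g31 far-strip generators): the DILUTE FLOOR (`hF₁` slot) of every far cell is the best of (i) the ORACLE DESK's far-strip QUARTER floors — Jensen in `(t′, U)` for the jointly concave `(t′,U) ↦ e` between ONE certified registry row at `(U₁, 1/2, −3/10)` (#674 `U₁ = 10` ∣ #606 `U₁ = 8` ∣ #649 `U₁ = 6`, claim nodes `h674`/`h606`/`h649` BY NAME) and the kernel free row at `t′ = −11/20`, then Griffiths monotonicity in `U`: `c₀ + c₁·s ≤ e(1,s,U,1/2)` for `s ∈ [−11/20,−3/10]`, `U ≥ (4s+11/5)·U₁` (`n1o2_farJensen{674,606,649}_strip_of`, `Certificates/HubbardSquare_n1o2_farstrip_lower_jensen606_674_649.lean`, hubbard-fast-surr-4 g10, p775085; `−0.9421 ∣ −0.9300` at `s = −2/5 ∣ −7/20` from #674 vs the FREE sea `−1.0206 ∣ −1.0532`: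 lifts `+0.078 ∣ +0.123`), used as is for `(≤ 1/2 ∣ ≥ 1)` and EXTRAPOLATED DOWN THE DENSITY by convexity of `n ↦ e` against the cell's best cap at `n₀ > 1/2` (`dilute_floor_of_halfFloor_of_cap`, g35) for `(≤ 9/20 ∣ ≥ 1)` / `(≤ 2/5 ∣ ≥ 1)`, and (ii) the free Fermi-sea `t′`-chord of the earlier editions — whichever gives the better word per cell (named in each docstring). RESULT: the FIRST `(≤ 1/2 ∣ ≥ 1)` words at `t′ < −3/10` (A1 `[−2/5,−7/20]`, A2 `[−7/20,−3/10]`, E3c `[−41/100,−2/5]`, E3 `[−9/20,−2/5]`). V16 FAR-STRIP edition («THE #660 PLANE», hubbard-downfold-unc-2 g38, generator `gen-g38/yb/gen38.py far …` over the g31 far-strip generators `gen31_cells.py` / `gen31_axes.py` / the K1 law): CAP per cell = the best of the tree's real-parameter caps on the segment — here almost everywhere the WITNESS-SPLIT PLANE of the CERTIFIED #660 strip state `(8, 3/4, −3/10)` at filling `3/4` (`T⁺ − B⁺·s + D⁺·U`, literals of record `−4440523991983/2⁴² ∣ 214787725653/2⁴⁴ ∣ 91533771269/2⁴²`, sr-mbsolver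 r211 V16, R12.73-signed; hypothesis `hV16` BY VALUE, cell form `holePlane_tcap_on_cell`, `Observables/PhaseSeparationExclusionHolePlaneCap.lean`; discharged BY NAME by a one-line `wsplit660_capPlane_of h660` the hour lit-4's claim node lands): a `t′ = −3/10` state, `0.05–0.10·t` below the WS597 plane (a `t′ = 0` state) and `0.02–0.07·t` below the kernel polarised caps on `t′ ∈ [−9/20, −3/10]`, `U ∈ [5, 13]`; DILUTE floors = `t′`-chords of the premise-free kernel Fermi-sea tangent rows (free sea; the far strip has no certified quarter-side LOWER); `n = 1` COLUMNS = the landed column laws BY NAME plus VIRTUAL columns (`vcol_of_laws`, `U`-chords of two landed laws: `fp_n1_col5_m40m30 ⊕ lowU_n1_law13o2_m40m30` at `U = 141/25, 32/5` on `[−2/5,−3/10]`, `fp_n1_col5_m55p0 ⊕ fp_n1_col8_m65m40` at `U = 141/25, 71/10` on `[−11/20,−2/5]` — the U_min edges 5.64 / 6.4 / 7.1 of the Bi2201 / NaCCOC-x0.20 / CCOC boxes) and gen33's `U = 6` A-segment column `es_n1_law6_m50m30` (BY VALUE `hN6m50`, `hB54`); `T > 0` dilute anchors = kernel free gas `β*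 = 4` incl. the NEW `n₁ = 9/20` certificates at `t′ = −9/20, −2/5, −7/20` (p767135–p767137, this seat g38). RESULT: `(≤ 9/20 ∣ ≥ 1)` — never typed before on `t′ < −3/10` — holds on A2 `[−7/20,−3/10] × [6, 13]` (margins 0.016–0.053), A1 `[−2/5,−7/20] × [32/5, 13]` (0.029–0.084), E3c `[−41/100,−2/5] × [141/25, 13]` (0.013–0.093), E3/E3s/E3t `× [8, 12]` (0.075–0.085): whole-box for Ca₂₋ₓNaₓCuO₂Cl₂ M36/M58 `[−0.41,−0.3] × [7.1,12.4]` and NaCCOC-x0.20 M57 `[−0.38,−0.27] × [6.4,12.9]`; `(≤ 2/5 ∣ ≥ 1)` NEW down to `U = 5` on A1/A2/E3c (Bi2201 M61/M62 `[−0.411,−0.31] × [5.64,7.27]`, PrSrNiO₂ M39b) and every A-strip threshold re-priced. Theorem names `gv…`/`gw…`. HONEST FRAMING: first certified bounds; not a superconductivity verdict. CLASS = DERIVED / CONTEXT (competing-order word, CONTROL class: the excluded partner phase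
has hole doping `≥ 3/4`). `T > 0` twins (canonical sector-Gibbs torus limits, `∀ β ≥ β₀`) of the hole-side `(≤ 1/4 | ≥ 1)` ground-state words of hubbard-box-p3
(`Observables/PhaseSeparationExclusion{FarOne*,FarPlanes*,WS597*,TPrimeStrip*}`, psbox v1.10): device = the `T > 0` column law
`psT_not_thermal_mix_on_cell_of_columns_hotAnchorSS_tcap` / `…above_column…` (this seat g25; Israel super-segment convexity + Poulin–Hastings free-entropy allowance +
Griffiths `U`-monotonicity); CAP per cell = whichever real-parameter cap of the tree gives the lowest threshold — the KERNEL FULLY-POLARISED band caps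
(`Certificates/HubbardTTPrime_polarizedBandCaps_kernel*`, hubbard-box-p3 g33: one spin species at density `1/2` or `5/8`, `U`-independent, no claim node), the kernel
Hartree–Fock planes, the registry r468 filling-`1/2` plane, or the registry WITNESS-SPLIT plane of the certified #597 state at filling `3/4` (`wsplit597_cap_tcap_on_cell`,
hubbard-box-p3 g34, claim node `cert_plaqseam_W4split597_TBD_allmk` BY NAME) — named in each docstring; `n = 1` COLUMNS = landed column laws BY NAME (`fy1_*`, `fp_n1_*`,
K2DIAG `lowU_n1_law*`, EXT5 `ext5_n1_*`, `xu_n1_*`, `far_n1_*`: their producer `n`-sheets `hsX…` (BY VALUE, CANDIDATE class where not referee-replayed), N-tier points `hN…`,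
registry nodes `h4xx` and K2DIAG bootstraps `hK…` appear in the signatures verbatim); DILUTE floors = `t′`-chords of the premise-free kernel Fermi-sea tangent rows at the
segment ends; `T > 0` ANCHORS = the kernel free `t–t′` gas at `β* = 4` (`free4_*`; certificates `Certificates/HubbardTTPrime_freeGC_kernelQuadrature_b4_*_dilute`, the
`n₁ = 2/5` editions at `t′ = −11/20, −1/2, −9/20, −7/20` appended this session) and the a-priori `n₂ = 1` anchor `2 log 2` (`apriori_hotCap_halfFilling_on_cell`) — NO thermal
claim node anywhere. `β₀ = max(β*, ⌈K/M⌉)` per cell from the exact column data printed in each docstring (generator asserts `K < β₀·M` in exact rationals at the corners;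
the kernel re-checks by `nlinarith`).

THIS FILE (cells; `β·t ≥ β₀` ⇔ `T ≤ t/(k_B β₀)`): `[49 / 10,5]` β ≥ 4 (POL_polHalf_m40m30) ∣ `[5,51 / 10]` β ≥ 4 (POL_polHalf_m40m30) ∣ `[51 / 10,21 / 4]` β ≥ 4 (POL_polHalf_m40m30) ∣ `[21 / 4,133 / 25]` β ≥ 4 (POL_polHalf_m40m30) ∣ `[133 / 25,11 / 2]` β ≥ 4 (POL_polHalf_m40m30) ∣ `[11 / 2,141 / 25]` β ≥ 4 (POL_polHalf_m40m30) ∣ `[141 / 25,6]` β ≥ 4 (POL_polHalf_m40m30) ∣ `[6,32 / 5]` β ≥ 4 (POL_polHalf_m40m30) ∣ `[32 / 5,13 / 2]` β ≥ 4 (POL_polHalf_m40m30) ∣ `[13 / 2,71 / 10]` β ≥ 4 (POL_polHalf_m40m30) ∣ `[71 / 10,8]` β ≥ 4 (POL_polHalf_m40m30) ∣ `[8,42 / 5]` β ≥ 4 (POL_polHalf_m40m30) ∣ `[42 / 5,10]` β ≥ 4 (POL_polHalf_m40m30) ∣ `[10,12]` β ≥ 4 (POL_polHalf_m40m30) ∣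 `[12,13]` β ≥ 4 (POL_polHalf_m40m30).
WHY: the `(≤ 2/5 ∣ ≥ 1)` sentence — «no macroscopic mixture of a ≥ 60 %-hole-doped phase with the half-filled-or-denser parent» — is the strongest hole-side word of the
T = 0 table (YBCO M18/M130/M64, Bi2212, CCOC, NdNiO₂, Bi2201, CB1, La-214 boxes) but had a `T > 0` column only on CB1 (β ≥ 14); the other sentences gain lower thresholds where
the WS597 / polarised caps beat the caps of record.
WHAT THIS IS NOT: a certificate or number of record; CONTROL-class words conditional BY NAME / BY VALUE on the premises printed in each signature; canonical sector-Gibbs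
torus limits (existence not claimed); nothing about stripes as states, ferromagnetism (a polarised CAP asserts none), superconductivity or `T_c`.

Seat hubbard-downfold-unc-2 g42 (`prover-hubbard-downfold-unc-2-g42-0`); generator `pub/hubbard-downfold/hubbard-downfold-unc-2/gen-g42/yb/gen42.py far` over `gen31_cells.py` (exact `fractions`;
column-law / cap tables imported read-only from hubbard-box-p3's `work-g33/far1/emit_far1.py` and `work-g34/ws597/{cells597,emit597}.py`).
[cite: Israel1979, Thm. I.2.4] [cite: EmeryKivelsonLin1990, pp. 475–476] [cite: PoulinHastings2011, eqs. (3)–(8)] [cite: Griffiths1966, §II] [cite: Ruelle1969, §3.4] [cite: BachLiebSolovej1994, eq. (2c.36)] [cite: LiebLoss1993, §8, Theorem 8.2]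
-/

noncomputable section

namespace Summit.Ventures.CertifiedManyBodySolver.Observables

open Summit.Ventures.CertifiedManyBodySolver.Certificates Summit.Ventures.CertifiedManyBodySolver.Downfold
open Literature.MathematicalPhysics.QuantumLattice Literature.MathematicalPhysics.QuantumLattice.ThermodynamicLimit
open Literature.MathematicalPhysics.QuantumLattice.InfVolFermionState Set Filter

/-- **`(≤ 1/4 | ≥ 1)` at `T > 0` — segment A1 `t′ ∈ [-2 / 5, -7 / 20]`, columns `U ∈ [12, 13]`, EVERY `β ≥ 4`** (`T ≲ 870–1451 K` for `t ∈ [0.30, 0.50] eV`).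
Witness filling `1 / 2` (weights `a, b = 2 / 3, 1 / 3`); cap = the PROVED kernel FULLY-POLARISED band cap `polHalf_m40m30` (one spin species at density `1 / 2`, `U`-independent; no claim node); `n = 1` column laws `ds_n1_law_U12_m40m35` ∣ `ds_n1_law_U13_m40m35` (landed, BY NAME; their producer anchors / registry
nodes appear in the signature exactly as in the cited law); dilute floor = per the module doc (far-strip QUARTER floor BY NAME where it wins, else the `t′`-chord of the kernel rows) `fermiSeaTangentRow_tPrime_neg_two_div_five_at_one_div_four` / `fermiSeaTangentRow_tPrime_neg_seven_div_twenty_at_one_div_four`; kernel free-gas dilute anchor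
`β* = 4` (`free4_1o4_tpm2o5_tpm7o20`), a-priori `n₂ = 1` anchor `2 log 2` — NO thermal claim node. Exact column data at `s = -2 / 5 ∣ -7 / 20` (`T = 0` margin M, anchored ratio K/M;
`β₀ = max(β*, ⌈K/M⌉)`): `U = 12`: M 0.3341∣0.3096, K/M 1.86∣1.91; `U = 13`: M 0.3420∣0.3175, K/M 1.82∣1.86. [cite: Israel1979, Thm. I.2.4] [cite: EmeryKivelsonLin1990, pp. 475–476] [cite: PoulinHastings2011, eqs. (3)–(8)] [cite: Griffiths1966, §II] [cite: Ruelle1969, §3.4] -/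
theorem wmT_1o4_A1_12to13_beta4 (hsX12m30n1 : ∀ m : ℝ, 0 ≤ m → m < 2 → (((-42844153095356934828307559/6044629098073145873530880 : ℚ)) : ℝ) + (((3680165511067/549755813888 : ℚ)) : ℝ) * m ≤ energyDensityTT' 1 (-3/10) (12) m) (hsX10m64n1 : ∀ m : ℝ, 0 ≤ m → m < 2 → (((-170408017018056602937101811/30223145490365729367654400 : ℚ)) : ℝ) + (((5640075348923/1099511627776 : ℚ)) : ℝ) * m ≤ energyDensityTT' 1 (-16/25) 10 m) (hsX147o10m30n1 : ∀ m : ℝ, 0 ≤ m → m < 2 → (((-2157082003289552899133347/188894659314785808547840 : ℚ)) : ℝ) + (((3048405340245/274877906944 : ℚ)) : ℝ) * m ≤ energyDensityTT' 1 (-3/10) (147/10) m)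
    {s : ℝ} (hs : s ∈ Icc (-2 / 5 : ℝ) (-7 / 20)) {U : ℝ} (hU : U ∈ Icc (12 : ℝ) (13))
    {β : ℝ} (hβ : (4 : ℝ) ≤ β)
    {ω₁ ω₂ : InfVolFermionState 2} (h₁ : ω₁.IsTranslationInvariant) (h₂ : ω₂.IsTranslationInvariant)
    (hρ₁ : 0 < ω₁.density) (hρ₁' : ω₁.density ≤ 1 / 4) (hρ₂ : 1 ≤ ω₂.density) (hρ₂' : ω₂.density < 2)
    {n : ℝ} (hn0 : 0 < n) (hn2 : n < 2) {lam : ℝ} (hl0 : 0 < lam) (hl1 : lam < 1) {Ls : ℕ → ℕ}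
    (hLs : Tendsto Ls atTop atTop) :
    ¬ (mix lam hl0.le hl1.le ω₁ ω₂).IsTorusLimitOfMixture (sectorGibbsCount n) (fun L => sectorGibbsWeightTT' β 1 s U n L)
      (fun L => sectorGibbsVectorTT' 1 s U n L) Ls := by
  refine psT_not_thermal_mix_on_cell_of_columns_hotAnchorSS_tcap 1 (s₁ := -2 / 5) (s₂ := -7 / 20) (U₁ := 12) (U₂ := 13)
    (n₁ := 1 / 4) (n₂ := 1) (a := 2 / 3) (b := 1 / 3) (β₀ := 4) (βh₁ := 4) (βh₂ := 0)
    (c₀ := ((-7920811/10000000 : ℚ) : ℝ)) (cs := ((1270943/10000000 : ℚ) : ℝ)) (c₁ := ((0 : ℚ) : ℝ))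
    (by norm_num) (by norm_num) (by norm_num) (by norm_num) (by norm_num) (by norm_num) (by norm_num) (by norm_num)
    (by norm_num) (by norm_num) (by norm_num) (by norm_num) hβ (by norm_num)
    (polHalf_m40m30_tcap_on_cell (by norm_num) (by norm_num) (by norm_num) (by norm_num))
    (fun s hs => ds_n1_law_U12_m40m35 hsX12m30n1 hsX10m64n1 hsX147o10m30n1 s ⟨hs.1.trans' (by norm_num), hs.2.trans (by norm_num)⟩)
    (fun s hs => ds_n1_law_U13_m40m35 hsX12m30n1 hsX10m64n1 hsX147o10m30n1 s ⟨hs.1.trans' (by norm_num), hs.2.trans (by norm_num)⟩)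
    (fun s hs U hU => floor_on_cell_of_tPrime_end_rows 1 (n := 1 / 4) (by norm_num) (by norm_num) (by norm_num)
      (fun _ hU' => fermiSeaTangentRow_tPrime_neg_two_div_five_at_one_div_four hU' (by norm_num) (by norm_num)) (fun _ hU' => fermiSeaTangentRow_tPrime_neg_seven_div_twenty_at_one_div_four hU' (by norm_num) (by norm_num)) s ⟨hs.1.trans' (by norm_num), hs.2.trans (by norm_num)⟩ U (by linarith [hU.1]))
    (free4_1o4_tpm2o5_tpm7o20 (by norm_num) (by norm_num) (by norm_num))
    (apriori_hotCap_halfFilling_on_cell (by norm_num))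
    ?_ ?_ ?_ ?_ hs hU h₁ h₂ hρ₁ hρ₁' hρ₂ hρ₂' hn0 hn2 hl0 hl1 hLs
  · intro s hs; obtain ⟨h1, h2⟩ := hs; push_cast; norm_num; nlinarith [h1, h2]
  · intro s hs; obtain ⟨h1, h2⟩ := hs; push_cast; norm_num; nlinarith [h1, h2]
  · intro s hs; obtain ⟨h1, h2⟩ := hs; push_cast; norm_num; nlinarith [h1, h2]
  · intro s hs; obtain ⟨h1, h2⟩ := hs; push_cast; norm_num; nlinarith [h1, h2]

end Summit.Ventures.CertifiedManyBodySolver.Observables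

end
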